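import Literature.MathematicalPhysics.QuantumFieldTheory.Balaban1983to89.B8Eq146AExpansion

/-!
# Bałaban, *The variational problem and background fields in renormalization group method for lattice gauge
theories*, CMP **102** (1985) 277–309 [B11] — (24)–(25) p. 282: the trace identity and the `z`-based plaquette
variable `∂₀U₁((p)_z)` with its second-order expansion

Honest framing: statement-level skeleton of published theorems with citation tags; proofs where landed; nothing
here is a claim about the Yang–Mills mass gap.

## What is printed (p. 282, render `…-p006-x2.png`)

«Using (1.21), (1.22) from [6] we have `tr(U₁U₀)(∂p) = tr ∂₀U₁((p)_z)U₀(∂p)`, (24) where for `p = ⟨x, y, z, w⟩`,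
`∂₀U₁((p)_z) = R(U₀(x, w))U₁(z, w)U₁(w, x)U₁(x, y)R(U₀(x, y))U₁(y, z)`
`= 1 + iη(R(U₀(x, w))A(z, w) + A(w, x) + A(x, y) + R(U₀(x, y))A(y, z))`
`− ½η²[(R(U₀(x, w))A(z, w))² + 2R(U₀(x, w))A(z, w)A(w, x) + 2R(U₀(x, w))A(z, w)A(x, y)`
`+ 2R(U₀(x, w))A(z, w)R(U₀(x, y))A(y, z) + (A(w, x))² + 2A(w, x)A(x, y) + 2A(w, x)R(U₀(x, y))A(y, z)`
`+ (A(x, y))² + 2A(x, y)R(U₀(x, y))A(y, z) + (R(U₀(x, y))A(y, z))²] + ⋯ (25)`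
The expression in parenthesis (…) on the right-hand side is equal to `η(DA)(p)`.»

## What is here (kernel-checked, sorry-free)

* §1 (group level) `covPlaqZ U₀ U₁ μ ν x = trail · lead` — the printed product of (25), i.e. the covariant plaquette
  variable (1.22) of [6] (`B8Eq143PlaqExpansion.covPlaq = lead · trail`) read along the contour `(p)_z` starting at
  `z` (our reading, not a printed sentence: the only difference from (1.22) of [6] is that `p` is traversed as a contour
  starting at the point `z` instead of `x` — [5] p. 390, after (3.1): «where for a plaquette p = ⟨x, y, z, w⟩ we define
  (p)_z = ⟨z, w, x, y⟩»): `covPlaqZ = lead⁻¹ · covPlaq · lead` (`covPlaqZ_eq_conj`).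
* §2 **(24)** for ANY tracial additive functional `τ` (`τ(ab) = τ(ba)`; e.g. `Matrix.trace`, `Matrix.trace_mul_comm`):
  `τ((U₁U₀)(∂p)) = τ(∂₀U₁((p)_z) · U₀(∂p))` — one cyclic permutation applied to (1.21) of [6]
  (`B8Eq143PlaqExpansion.eq121`: `(U₁U₀)(∂p) = lead · U₀(∂p) · trail`).
* §3 **(25)** for `U₁ = e^{B}` (`B8Eq146AExpansion.expCfg`; print: `B = iηA`): the exponential product in the printed
  `z`-order `e^{X₃}e^{X₄}·e^{X₁}e^{X₂}` (`Xᵢ` = the four variables of `B8Eq146AExpansion`, `X₃ = R(U₀(x,w))B(z,w)`,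
  `X₄ = B(w,x)`, `X₁ = B(x,y)`, `X₂ = R(U₀(x,y))B(y,z)`), its first-order term `linZ = X₃ + X₄ + X₁ + X₂` (= the
  `x`-ordered `lin`, hence `= η(D^η_{U₀}B)(p)` by (3.4) of [5]: «The expression in parenthesis (…) on the right-hand
  side is equal to η(DA)(p)» — `linZ_eq_smul_plaqCovDeriv`), the VERBATIM bracket `V2Z` of (25) and the second-order Taylor data
  `T2 (∂₀e^{B}((p)_z)) linZ quadZ (Σ_{b⊂∂p}|B_b|)` (`taylor_covPlaqZF`), i.e.
  `|∂₀e^{B}((p)_z) − 1 − Σᵢ Xᵢ − ½V2Z| ≤ ρ₃(Σ_b |B_b|)` (`eq25`), and the same after right multiplication by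
  `U₀(∂p)` with `|U₀(∂p)| ≤ 1` (`eq25_mul_plaqF`, the per-plaquette input of (26)).

## HONEST SCOPE — what is NOT claimed

(26) itself (the sum over `p ⊂ Ω₀`, the identification of the quadratic form with `½⟨A, ΔA⟩` of [5] (3.7)/(3.10),
the definition of `V₀(A)`), (27)–(28) and the `Re`/`Im tr` bookkeeping are NOT typed here; `U₁(z, w)` is read as
`U₁(w, z)⁻¹` and `A(z, w) = −A(w, z)` ((9) of [3], (3.5) of [5]) exactly as in `B8Eq143PlaqExpansion` /
`B8Eq146AExpansion`, whose HONEST SCOPE (i) (the `U′(y, z)` reading of (1.22)) is inherited.  Nothing here is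
progress on the summit `Summit.QuantumFields`.

(v1.1 DOCFIX, r08 gen 28, QUOTE-AUDIT-B11 A3/L1: the v1 header and the docstring of `covPlaqZ_eq_conj` carried our own
gloss «the only difference is that we consider p as a contour starting at the point z instead of x» inside «…» with the
locator «p. 283» — no such sentence is printed in [B11] (pp. 282–283 checked on the page images) nor in [6]/[5]; it is
now marked as a reading, with [5] p. 390's definition of `(p)_z` quoted instead; and §3's clip of p. 282's sentence
restored to the verbatim «The expression in parenthesis (…) on the right-hand side is equal to η(DA)(p)». Declarations
and proofs byte-identical.)
-/

noncomputable section

open NormedSpace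

namespace Literature.MathematicalPhysics.QuantumFieldTheory.Balaban1983to89.B11Eq24TraceExpansion

open B7Prop1Explicit
open B7Eq78Linearization (conjR conjR_apply conjR_smul)
open B8Lemma1NonAbelian (mulCfg)
open B8Ineq132 (plaqF norm_conjR_le)
open B8Eq143PlaqExpansion (lead trail covPlaq eq121 val_lead val_trail)
open B8Eq146AExpansion (X1 X2 X3 X4 lin quad bdry expCfg T2 exp_conjR plaqCovDeriv lin_eq_smul_plaqCovDeriv
  expRem3 conjR_neg)

-- `Site` alone would resolve to the torus sites of `Setup.lean`; re-export the `ℤ^d` sites of `B7Prop1Explicit`.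
export B7Prop1Explicit (Site)

variable {d : ℕ}

/-! ## §1 The `z`-based covariant plaquette variable `∂₀U₁((p)_z)` of (25) -/

section GroupLevel

variable {G : Type*} [Group G]

/-- **(25), first line**: `∂₀U₁((p)_z) = R(U₀(x, w))U₁(z, w)·U₁(w, x)·U₁(x, y)·R(U₀(x, y))U₁(y, z)` for
`p = ⟨x, y, z, w⟩`, `y = x + e_μ`, `w = x + e_ν`, read with `U₁(z, w) = U₁(w, z)⁻¹`, `U₁(w, x) = U₁(x, w)⁻¹`: in the
tree's factorisation of (1.21) [6] this is `trail · lead`. [cite: Balaban1985Variational, (25) p.282] -/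
def covPlaqZ (U₀ U₁ : Site d → Fin d → G) (μ ν : Fin d) (x : Site d) : G :=
  trail U₀ U₁ μ ν x * lead U₀ U₁ μ ν x

/-- (25) spelled out factor by factor: `[U₀(x,w)U₁(w,z)⁻¹U₀(x,w)⁻¹]·U₁(x,w)⁻¹·(U₁(x,y)·[U₀(x,y)U₁(y,z)U₀(x,y)⁻¹])`.
[cite: Balaban1985Variational, (25) p.282] -/
theorem covPlaqZ_eq (U₀ U₁ : Site d → Fin d → G) (μ ν : Fin d) (x : Site d) :
    covPlaqZ U₀ U₁ μ ν x =
      U₀ x ν * (U₁ (x + e ν) μ)⁻¹ * (U₀ x ν)⁻¹ * (U₁ x ν)⁻¹ *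
        (U₁ x μ * (U₀ x μ * U₁ (x + e μ) ν * (U₀ x μ)⁻¹)) := by
  simp only [covPlaqZ, lead, trail]

/-- The `z`-based contour variable versus the `x`-based one (our reading of (24)–(25) against (1.22) of [6]; [5] p. 390
«we define (p)_z = ⟨z, w, x, y⟩»): `∂₀U₁((p)_z)` is the conjugate of the `x`-based variable `(∂_{U₀}U₁)(p) = lead · trail`
of (1.22) [6] by the transporter `lead = U₁(x,y)R(U₀(x,y))U₁(y,z)` from `x` to `z`. [cite: Balaban1985Variational, (24)–(25) p.282]
[cite: Balaban1985BackgroundPropagators, (3.1) p.390] -/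
theorem covPlaqZ_eq_conj (U₀ U₁ : Site d → Fin d → G) (μ ν : Fin d) (x : Site d) :
    covPlaqZ U₀ U₁ μ ν x = (lead U₀ U₁ μ ν x)⁻¹ * covPlaq U₀ U₁ μ ν x * lead U₀ U₁ μ ν x := by
  simp only [covPlaqZ, covPlaq, ← mul_assoc, inv_mul_cancel, one_mul]

end GroupLevel

/-! ## §2 (24): the trace identity -/

section Trace

variable {𝔸 : Type*} [NormedRing 𝔸]

/-- The `𝔸`-valued `z`-based plaquette variable `∂₀U₁((p_{μν}(x))_z)`. [cite: Balaban1985Variational, (25) p.282] -/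
def covPlaqZF (U₀ U₁ : Site d → Fin d → 𝔸ˣ) (μ ν : Fin d) (x : Site d) : 𝔸 :=
  ((covPlaqZ U₀ U₁ μ ν x : 𝔸ˣ) : 𝔸)

/-- (1.21) of [6] regrouped: `(U₁U₀)(∂p) = a·b` and `∂₀U₁((p)_z)·U₀(∂p) = b·a` with `a = lead·U₀(∂p)`,
`b = trail` — the two sides of (24) are one cyclic permutation apart. [cite: Balaban1985Variational, (24) p.282] -/
theorem eq24_cyclic (U₀ U₁ : Site d → Fin d → 𝔸ˣ) (μ ν : Fin d) (x : Site d) :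
    plaqF (mulCfg U₁ U₀) μ ν x = ((lead U₀ U₁ μ ν x : 𝔸ˣ) : 𝔸) * plaqF U₀ μ ν x * ((trail U₀ U₁ μ ν x : 𝔸ˣ) : 𝔸)
      ∧ covPlaqZF U₀ U₁ μ ν x * plaqF U₀ μ ν x =
        ((trail U₀ U₁ μ ν x : 𝔸ˣ) : 𝔸) * (((lead U₀ U₁ μ ν x : 𝔸ˣ) : 𝔸) * plaqF U₀ μ ν x) := by
  refine ⟨eq121 U₀ U₁ μ ν x, ?_⟩
  rw [covPlaqZF, covPlaqZ, Units.val_mul, mul_assoc]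

/-- **(24)** `tr(U₁U₀)(∂p) = tr ∂₀U₁((p)_z)U₀(∂p)` — for every additive functional `τ` with the trace property
`τ(ab) = τ(ba)` (for `N × N` matrices: `Matrix.trace`, `Matrix.trace_mul_comm`).
[cite: Balaban1985Variational, (24) p.282] -/
theorem eq24 {M : Type*} [AddCommMonoid M] (τ : 𝔸 →+ M) (hτ : ∀ a b : 𝔸, τ (a * b) = τ (b * a))
    (U₀ U₁ : Site d → Fin d → 𝔸ˣ) (μ ν : Fin d) (x : Site d) :
    τ (plaqF (mulCfg U₁ U₀) μ ν x) = τ (covPlaqZF U₀ U₁ μ ν x * plaqF U₀ μ ν x) := by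
  obtain ⟨h₁, h₂⟩ := eq24_cyclic U₀ U₁ μ ν x
  rw [h₁, h₂, hτ]

end Trace

/-! ## §3 (25): `∂₀U₁((p)_z)` for `U₁ = e^{B}` and its expansion to the second order -/

section Polys

variable {𝔸 : Type*} [NormedRing 𝔸] [NormedAlgebra ℂ 𝔸]

/-- THE FIRST-ORDER TERM OF (25) in the printed `z`-order:
`R(U₀(x, w))A(z, w) + A(w, x) + A(x, y) + R(U₀(x, y))A(y, z) = X₃ + X₄ + X₁ + X₂`.
[cite: Balaban1985Variational, (25) p.282] -/
def linZ (U₀ : Site d → Fin d → 𝔸ˣ) (A : Site d → Fin d → 𝔸) (μ ν : Fin d) (x : Site d) : 𝔸 :=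
  X3 U₀ A μ ν x + X4 A ν x + X1 A μ x + X2 U₀ A μ ν x

/-- **(25), the bracket** VERBATIM: `(R(U₀(x,w))A(z,w))² + 2R(U₀(x,w))A(z,w)A(w,x) + 2R(U₀(x,w))A(z,w)A(x,y)
+ 2R(U₀(x,w))A(z,w)R(U₀(x,y))A(y,z) + (A(w,x))² + 2A(w,x)A(x,y) + 2A(w,x)R(U₀(x,y))A(y,z) + (A(x,y))²
+ 2A(x,y)R(U₀(x,y))A(y,z) + (R(U₀(x,y))A(y,z))²` (ordered products, `2XY` read as `2·(XY)`; this is (1.49) of [6]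
with the pairs ordered along `(p)_z`). [cite: Balaban1985Variational, (25) p.282] -/
def V2Z (U₀ : Site d → Fin d → 𝔸ˣ) (A : Site d → Fin d → 𝔸) (μ ν : Fin d) (x : Site d) : 𝔸 :=
  X3 U₀ A μ ν x * X3 U₀ A μ ν x + 2 * (X3 U₀ A μ ν x * X4 A ν x) + 2 * (X3 U₀ A μ ν x * X1 A μ x)
    + 2 * (X3 U₀ A μ ν x * X2 U₀ A μ ν x) + X4 A ν x * X4 A ν x + 2 * (X4 A ν x * X1 A μ x)
    + 2 * (X4 A ν x * X2 U₀ A μ ν x) + X1 A μ x * X1 A μ x + 2 * (X1 A μ x * X2 U₀ A μ ν x)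
    + X2 U₀ A μ ν x * X2 U₀ A μ ν x

/-- THE SECOND-ORDER TERM of `e^{X₃}e^{X₄}e^{X₁}e^{X₂}`: `½ΣᵢXᵢ² + Σ_{i≺j}XᵢXⱼ`, `≺` the order `3, 4, 1, 2` of the
bonds of `(p)_z` (`= ½·V2Z`, `V2Z_eq_two_smul_quadZ`). [cite: Balaban1985Variational, (25) p.282, (34) p.283] -/
def quadZ (U₀ : Site d → Fin d → 𝔸ˣ) (A : Site d → Fin d → 𝔸) (μ ν : Fin d) (x : Site d) : 𝔸 :=
  (2 : ℂ)⁻¹ • (X3 U₀ A μ ν x * X3 U₀ A μ ν x + X4 A ν x * X4 A ν x + X1 A μ x * X1 A μ x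
      + X2 U₀ A μ ν x * X2 U₀ A μ ν x)
    + (X3 U₀ A μ ν x * X4 A ν x + X3 U₀ A μ ν x * X1 A μ x + X3 U₀ A μ ν x * X2 U₀ A μ ν x
      + X4 A ν x * X1 A μ x + X4 A ν x * X2 U₀ A μ ν x + X1 A μ x * X2 U₀ A μ ν x)

omit [NormedAlgebra ℂ 𝔸] in
/-- The first-order term does not see the base point: `X₃ + X₄ + X₁ + X₂ = X₁ + X₂ + X₃ + X₄` (the `x`-ordered
`lin` of `B8Eq146AExpansion`). [cite: Balaban1985Variational, (25) p.282] -/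
theorem linZ_eq_lin (U₀ : Site d → Fin d → 𝔸ˣ) (A : Site d → Fin d → 𝔸) (μ ν : Fin d) (x : Site d) :
    linZ U₀ A μ ν x = lin U₀ A μ ν x := by
  simp only [linZ, lin]
  abel

/-- «The expression in parenthesis (…) on the right-hand side is equal to η(DA)(p)»: with the plaquette covariant
derivative (3.4) of [5] (`B8Eq146AExpansion.plaqCovDeriv`), `X₃ + X₄ + X₁ + X₂ = η·(D^η_{U₀}A)(p)` (`η ≠ 0`).
[cite: Balaban1985Variational, (25) p.282] -/
theorem linZ_eq_smul_plaqCovDeriv {η : ℝ} (hη : η ≠ 0) (U₀ : Site d → Fin d → 𝔸ˣ) (A : Site d → Fin d → 𝔸)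
    (μ ν : Fin d) (x : Site d) : linZ U₀ A μ ν x = η • plaqCovDeriv η U₀ A μ ν x := by
  rw [linZ_eq_lin, lin_eq_smul_plaqCovDeriv hη]

/-- `V2Z = 2·quadZ`. [cite: Balaban1985Variational, (25) p.282] -/
theorem V2Z_eq_two_smul_quadZ (U₀ : Site d → Fin d → 𝔸ˣ) (A : Site d → Fin d → 𝔸) (μ ν : Fin d) (x : Site d) :
    V2Z U₀ A μ ν x = (2 : ℂ) • quadZ U₀ A μ ν x := by
  simp only [V2Z, quadZ, smul_add, smul_smul, mul_inv_cancel₀ (two_ne_zero (α := ℂ)), one_smul, two_smul,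
    two_mul]
  abel

/-- `linZ(cA) = c·linZ(A)`. [cite: Balaban1985Variational, (25) p.282] -/
theorem linZ_smul (U₀ : Site d → Fin d → 𝔸ˣ) (A : Site d → Fin d → 𝔸) (c : ℂ) (μ ν : Fin d) (x : Site d) :
    linZ U₀ (fun y κ => c • A y κ) μ ν x = c • linZ U₀ A μ ν x := by
  simp only [linZ, X1, X2, X3, X4, ← smul_neg, conjR_smul, smul_add]

/-- `quadZ(cA) = c²·quadZ(A)`. [cite: Balaban1985Variational, (25) p.282] -/
theorem quadZ_smul (U₀ : Site d → Fin d → 𝔸ˣ) (A : Site d → Fin d → 𝔸) (c : ℂ) (μ ν : Fin d) (x : Site d) :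
    quadZ U₀ (fun y κ => c • A y κ) μ ν x = c ^ 2 • quadZ U₀ A μ ν x := by
  simp only [quadZ, X1, X2, X3, X4, ← smul_neg, conjR_smul, smul_mul_assoc, mul_smul_comm, smul_smul]
  module

/-- `V2Z(cA) = c²·V2Z(A)`. [cite: Balaban1985Variational, (25) p.282] -/
theorem V2Z_smul (U₀ : Site d → Fin d → 𝔸ˣ) (A : Site d → Fin d → 𝔸) (c : ℂ) (μ ν : Fin d) (x : Site d) :
    V2Z U₀ (fun y κ => c • A y κ) μ ν x = c ^ 2 • V2Z U₀ A μ ν x := by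
  rw [V2Z_eq_two_smul_quadZ, V2Z_eq_two_smul_quadZ, quadZ_smul, smul_comm]

end Polys

section Plaquette

variable {𝔸 : Type*} [NormedRing 𝔸] [NormedAlgebra ℂ 𝔸] [CompleteSpace 𝔸]

/-- **(25), first line, for `U₁ = e^{B}`**: `∂₀e^{B}((p)_z) = e^{R(U₀(x,w))B(z,w)}·e^{B(w,x)}·(e^{B(x,y)}·e^{R(U₀(x,y))B(y,z)})
= e^{X₃}e^{X₄}·(e^{X₁}e^{X₂})` (print: `B = iηA`, «= Π_{b⊂(∂p)_z} exp iηA′(b)» of (34)), by `R(u)e^{X} = e^{R(u)X}`,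
`(e^{X})⁻¹ = e^{−X}`. [cite: Balaban1985Variational, (25) p.282, (34) p.283] -/
theorem covPlaqZF_expCfg (U₀ : Site d → Fin d → 𝔸ˣ) (B : Site d → Fin d → 𝔸) (μ ν : Fin d) (x : Site d) :
    covPlaqZF U₀ (expCfg B) μ ν x =
      exp (X3 U₀ B μ ν x) * exp (X4 B ν x) * (exp (X1 B μ x) * exp (X2 U₀ B μ ν x)) := by
  simp only [covPlaqZF, covPlaqZ, Units.val_mul, val_lead, val_trail, expCfg, val_inv_expUnit, val_expUnit,
    ← exp_conjR]
  rfl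

variable [NormOneClass 𝔸]

/-- THE SECOND-ORDER TAYLOR DATA OF (25): for `U1`-valued `U₀`,
`∂₀e^{B}((p)_z) = 1 + (X₃ + X₄ + X₁ + X₂) + (½ΣᵢXᵢ² + Σ_{i≺j}XᵢXⱼ) + O₁(ρ₃(s))`, `s = Σ_{b⊂∂p}|B_b|`.
[cite: Balaban1985Variational, (25) p.282] -/
theorem taylor_covPlaqZF {U₀ : Site d → Fin d → 𝔸ˣ} (h₀ : ∀ y κ, U₀ y κ ∈ U1 𝔸) (B : Site d → Fin d → 𝔸)
    (μ ν : Fin d) (x : Site d) :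
    T2 (covPlaqZF U₀ (expCfg B) μ ν x) (linZ U₀ B μ ν x) (quadZ U₀ B μ ν x) (bdry B μ ν x) := by
  have h1 : T2 (exp (X1 B μ x)) (X1 B μ x) ((2 : ℂ)⁻¹ • (X1 B μ x * X1 B μ x)) ‖B x μ‖ := T2.exp le_rfl
  have h2 : T2 (exp (X2 U₀ B μ ν x)) (X2 U₀ B μ ν x) ((2 : ℂ)⁻¹ • (X2 U₀ B μ ν x * X2 U₀ B μ ν x))
      ‖B (x + e μ) ν‖ := T2.exp (norm_conjR_le (h₀ x μ) _)
  have h3 : T2 (exp (X3 U₀ B μ ν x)) (X3 U₀ B μ ν x) ((2 : ℂ)⁻¹ • (X3 U₀ B μ ν x * X3 U₀ B μ ν x))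
      ‖B (x + e ν) μ‖ := T2.exp ((norm_conjR_le (h₀ x ν) _).trans (norm_neg _).le)
  have h4 : T2 (exp (X4 B ν x)) (X4 B ν x) ((2 : ℂ)⁻¹ • (X4 B ν x * X4 B ν x)) ‖B x ν‖ :=
    T2.exp (norm_neg _).le
  have h := (h3.mul h4).mul (h1.mul h2)
  rw [covPlaqZF_expCfg]
  refine h.congr ?_ ?_ ?_
  · simp only [linZ]
    abel
  · simp only [quadZ, smul_add, mul_add, add_mul]
    abel
  · simp only [bdry]
    ring

/-- **(25)** (sharp remainder): `|∂₀e^{B}((p)_z) − 1 − (X₃ + X₄ + X₁ + X₂) − ½·V2Z(B)| ≤ ρ₃(Σ_{b⊂∂p}|B_b|)`,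
`ρ₃(s) = e^s − 1 − s − s²/2`; at `B = iηA` the two displayed orders of (25) are `iη(…)` and `−½η²[…]`
(`linZ_smul`, `V2Z_smul` with `c = iη`, `c² = −η²`). [cite: Balaban1985Variational, (25) p.282] -/
theorem eq25 {U₀ : Site d → Fin d → 𝔸ˣ} (h₀ : ∀ y κ, U₀ y κ ∈ U1 𝔸) (B : Site d → Fin d → 𝔸) (μ ν : Fin d)
    (x : Site d) :
    ‖covPlaqZF U₀ (expCfg B) μ ν x - 1 - linZ U₀ B μ ν x - (2 : ℂ)⁻¹ • V2Z U₀ B μ ν x‖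
      ≤ expRem3 (bdry B μ ν x) := by
  rw [V2Z_eq_two_smul_quadZ, smul_smul, inv_mul_cancel₀ (two_ne_zero (α := ℂ)), one_smul]
  exact (taylor_covPlaqZF h₀ B μ ν x).ord2

/-- **(25) at `B = iηA`**, the printed shape: `|∂₀U₁((p)_z) − 1 − iη(ΣA′) + ½η²[V2Z(A)]| ≤ ρ₃(η·Σ_{b⊂∂p}|A_b|)`
for `U₁ = e^{iηA}`, `η ≥ 0`. [cite: Balaban1985Variational, (25) p.282] -/
theorem eq25_printed {U₀ : Site d → Fin d → 𝔸ˣ} (h₀ : ∀ y κ, U₀ y κ ∈ U1 𝔸) (A : Site d → Fin d → 𝔸)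
    {η : ℝ} (hη : 0 ≤ η) (μ ν : Fin d) (x : Site d) :
    ‖covPlaqZF U₀ (expCfg fun y κ => (Complex.I * η) • A y κ) μ ν x - 1
        - (Complex.I * η) • linZ U₀ A μ ν x + ((η ^ 2 / 2 : ℝ) : ℂ) • V2Z U₀ A μ ν x‖
      ≤ expRem3 (η * bdry A μ ν x) := by
  have h := eq25 h₀ (fun y κ => (Complex.I * η) • A y κ) μ ν x
  rw [linZ_smul, V2Z_smul, smul_smul] at h
  have hc : (2 : ℂ)⁻¹ * (Complex.I * η) ^ 2 = -(((η ^ 2 / 2 : ℝ) : ℂ)) := by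
    rw [mul_pow, Complex.I_sq]
    push_cast
    ring
  have hb : bdry (fun y κ => (Complex.I * ↑η) • A y κ) μ ν x = η * bdry A μ ν x := by
    simp only [bdry, norm_smul, norm_mul, Complex.norm_I, Complex.norm_real, Real.norm_eq_abs, abs_of_nonneg hη,
      one_mul]
    ring
  rwa [hc, neg_smul, sub_neg_eq_add, hb] at h

/-- The per-plaquette input of (26): after right multiplication by `U₀(∂p)` (`|U₀(∂p)| ≤ 1` for `U1`-valued `U₀`),
`|∂₀e^{B}((p)_z)U₀(∂p) − U₀(∂p) − (ΣᵢXᵢ)U₀(∂p) − quadZ·U₀(∂p)| ≤ ρ₃(Σ_{b⊂∂p}|B_b|)`.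
[cite: Balaban1985Variational, (24)-(26) p.282] -/
theorem eq25_mul_plaqF {U₀ : Site d → Fin d → 𝔸ˣ} (h₀ : ∀ y κ, U₀ y κ ∈ U1 𝔸) (B : Site d → Fin d → 𝔸)
    (μ ν : Fin d) (x : Site d) :
    ‖covPlaqZF U₀ (expCfg B) μ ν x * plaqF U₀ μ ν x - plaqF U₀ μ ν x - linZ U₀ B μ ν x * plaqF U₀ μ ν x
        - quadZ U₀ B μ ν x * plaqF U₀ μ ν x‖ ≤ expRem3 (bdry B μ ν x) := by
  have hP : ‖plaqF U₀ μ ν x‖ ≤ 1 := (hol_mem h₀ x (plaqWord μ ν)).1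
  have heq : covPlaqZF U₀ (expCfg B) μ ν x * plaqF U₀ μ ν x - plaqF U₀ μ ν x
      - linZ U₀ B μ ν x * plaqF U₀ μ ν x - quadZ U₀ B μ ν x * plaqF U₀ μ ν x
      = (covPlaqZF U₀ (expCfg B) μ ν x - 1 - linZ U₀ B μ ν x - quadZ U₀ B μ ν x) * plaqF U₀ μ ν x := by
    noncomm_ring
  rw [heq]
  calc _ ≤ ‖covPlaqZF U₀ (expCfg B) μ ν x - 1 - linZ U₀ B μ ν x - quadZ U₀ B μ ν x‖ * ‖plaqF U₀ μ ν x‖ :=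
        norm_mul_le _ _
    _ ≤ expRem3 (bdry B μ ν x) * 1 := by
        gcongr
        · exact B8Eq146AExpansion.expRem3_nonneg (T2.nonneg (taylor_covPlaqZF h₀ B μ ν x))
        · exact (taylor_covPlaqZF h₀ B μ ν x).ord2
    _ = expRem3 (bdry B μ ν x) := mul_one _

end Plaquette

end Literature.MathematicalPhysics.QuantumFieldTheory.Balaban1983to89.B11Eq24TraceExpansion
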